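import Summits.CriticalPhenomena.CardyFormulaZ2.Theorems.CardySelfRefinementLagHandOffNoTraceArms
import HarnessLib

/-!
# No idling of the limit interface, part 1: traversal data for general discrete data

Helper file for the registered stub `stub_limitCurveRegularity_noIdle` of line
`hitting-tournament` of crux `LagHandOff` (stmt-CriticalPhenomena-10268).  The tree's
`traversal_data` (`InterfaceTraversalBound.lean`, Part III: from a traversal of a shell by the
exploration polygon to a tight stretch of darts, a middle dart whose side segment lies in the
open annulus, and the radii bookkeeping) is stated for the CANONICAL data `dobrushinData D δ`;
the no-idling estimate needs it for an arbitrary admissible discretisation `D'` (the data `E δ`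
of a `ZdDiscretisationFamily`).  This file is that generalisation, `traversal_data'`, with the
same statement and proof (the only canonical-data inputs of the printed proof,
`dist_polyline_cv_le` and `tIdx_lt`, are replaced by their general forms
`dist_polyline_cv_le'`, `tIdx_lt_length` of `…NoTraceArms.lean`).

References: M. Aizenman, A. Burchard, Duke Math. J. 99 (1999), Appendix A (sectors cut by the
crossing segments); S. Smirnov, C. R. Acad. Sci. 333 (2001) §2 (the medial exploration polygon).
-/

noncomputable section

open MeasureTheory Filter Set Topology Metric
open scoped unitInterval
open Literature.Probability.Percolation Literature.Probability.LatticeModels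
open Literature.Probability.RandomPlanarGeometry
open Literature.Probability.LatticeModels.IsMedialExploration

namespace Summit.CriticalPhenomena.CardyFormulaZ2.Cruxes.LagHandOff.HittingTournament

variable {D' : DiscreteDobrushin} {ω : BondConfig (Site 2)} {a : MedialVertex}
  {l : List MedialVertex}

-- adapted from `Literature.Probability.Percolation.traversal_data` (InterfaceTraversalBound.lean,
-- Part III), verbatim up to the replacement of the canonical data by general data `D'`
/-- **Data of a traversal (general discrete Dobrushin data).** Let the exploration polygon of
`ω` in the discrete data `D'` (mesh `δ ≤ ρ`) traverse the shell `D(x; ρ, R)` between the times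
`s ≤ t`, with `R ≥ 16Cρ`, `C ≥ 16`. Then there are dart indices `i' ≤ m ≤ j'` strictly
between `tIdx s` and `tIdx t` such that: the stretch over `[tIdx s, tIdx t]` joins the disc
`B̄(x, 4ρ)` to the outside of `B(x, R/2)` (in one of the two directions); the side segment of
the middle dart `m` lies in the annulus `𝔸 = B(x, R/2) ∖ B̄(x, 4ρ)`; the `4δ`-neighbourhoods
of the vertices of the darts `i', …, j'` lie in `𝔸`, these vertices being at distance within
`δ` of `[Cρ, R/4]` from `x`; and the stretch `i', …, j'` joins `B̄(x, Cρ + δ)` to the outside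
of `B(x, R/4 - δ)`. [cite: AizenmanBurchardDuke1999, Appendix A] -/
theorem traversal_data' (hexp : IsMedialExploration D' ω (a :: l)) (hδ : 0 < D'.δ)
    {x : ℂ} {ρ R C : ℝ} (hδρ : D'.δ ≤ ρ) (hC : 16 ≤ C) (hR : 16 * C * ρ ≤ R) {s t : I}
    (hst : (⟨polyline ((a :: l).map (medialPoint D'.δ))⟩ : Curve ℂ).IsTraversal x ρ R s t) :
    ∃ m i' j' : ℕ, tIdx l s < m ∧ m < tIdx l t ∧ i' ≤ m ∧ m ≤ j' ∧ tIdx l s ≤ i' ∧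
      j' ≤ tIdx l t ∧
      ((dist (hexp.pS (tIdx l s)) x ≤ 4 * ρ ∧ R / 2 ≤ dist (hexp.pT (tIdx l t)) x) ∨
        (R / 2 ≤ dist (hexp.pS (tIdx l s)) x ∧ dist (hexp.pT (tIdx l t)) x ≤ 4 * ρ)) ∧
      hexp.sideSeg m ⊆ ball x (R / 2) \ closedBall x (4 * ρ) ∧
      (∀ i, i' ≤ i → i ≤ j' →
        closedBall (meshPoint D'.δ (hexp.cv i)) (4 * D'.δ) ⊆ ball x (R / 2) \ closedBall x (4 * ρ)) ∧
      (∀ i, i' ≤ i → i ≤ j' →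
        C * ρ - D'.δ ≤ dist (meshPoint D'.δ (hexp.cv i)) x ∧
          dist (meshPoint D'.δ (hexp.cv i)) x ≤ R / 4 + D'.δ) ∧
      ((dist (meshPoint D'.δ (hexp.cv i')) x ≤ C * ρ + D'.δ ∧
          R / 4 - D'.δ ≤ dist (meshPoint D'.δ (hexp.cv j')) x) ∨
        (R / 4 - D'.δ ≤ dist (meshPoint D'.δ (hexp.cv i')) x ∧
          dist (meshPoint D'.δ (hexp.cv j')) x ≤ C * ρ + D'.δ)) := by
  set δ := D'.δ with hδdef
  have hρ : 0 < ρ := hδ.trans_le hδρ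
  set γ : I → ℂ := fun u => polyline ((a :: l).map (medialPoint δ)) u with hγ
  set f : I → ℝ := fun u => dist (γ u) x with hf
  have hfc : Continuous f :=
    ((polyline ((a :: l).map (medialPoint δ))).continuous).dist continuous_const
  -- the mesh point of `cv (tIdx u)` is within `δ` of `γ u`
  have hnear : ∀ u, dist (meshPoint δ (hexp.cv (tIdx l u))) x ≤ f u + δ ∧
      f u - δ ≤ dist (meshPoint δ (hexp.cv (tIdx l u))) x := by
    intro u
    have h := dist_polyline_cv_le' hexp hδ.le u
    constructor
    · linarith [dist_triangle (meshPoint δ (hexp.cv (tIdx l u))) (γ u) x,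
        dist_comm (γ u) (meshPoint δ (hexp.cv (tIdx l u)))]
    · linarith [dist_triangle (γ u) (meshPoint δ (hexp.cv (tIdx l u))) x]
  -- shifted points of the dart `tIdx u` are within `3δ` of `γ u`
  have hpS : ∀ u, dist (hexp.pS (tIdx l u)) x ≤ f u + 3 * δ ∧
      f u - 3 * δ ≤ dist (hexp.pT (tIdx l u)) x ∧
      f u - 3 * δ ≤ dist (hexp.pS (tIdx l u)) x ∧ dist (hexp.pT (tIdx l u)) x ≤ f u + 3 * δ := by
    intro u
    have h := dist_polyline_cv_le' hexp hδ.le u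
    have h1 := (hexp.dist_pS_le hδ (tIdx_lt_length hexp u)).1
    have h2 := (hexp.dist_pS_le hδ (tIdx_lt_length hexp u)).2
    refine ⟨?_, ?_, ?_, ?_⟩
    · linarith [dist_triangle (hexp.pS (tIdx l u)) (meshPoint δ (hexp.cv (tIdx l u))) x,
        dist_triangle (meshPoint δ (hexp.cv (tIdx l u))) (γ u) x,
        dist_comm (γ u) (meshPoint δ (hexp.cv (tIdx l u)))]
    · linarith [dist_triangle (γ u) (meshPoint δ (hexp.cv (tIdx l u))) x,
        dist_triangle (meshPoint δ (hexp.cv (tIdx l u))) (hexp.pT (tIdx l u)) x,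
        dist_comm (hexp.pT (tIdx l u)) (meshPoint δ (hexp.cv (tIdx l u)))]
    · linarith [dist_triangle (γ u) (meshPoint δ (hexp.cv (tIdx l u))) x,
        dist_triangle (meshPoint δ (hexp.cv (tIdx l u))) (hexp.pS (tIdx l u)) x,
        dist_comm (hexp.pS (tIdx l u)) (meshPoint δ (hexp.cv (tIdx l u)))]
    · linarith [dist_triangle (hexp.pT (tIdx l u)) (meshPoint δ (hexp.cv (tIdx l u))) x,
        dist_triangle (meshPoint δ (hexp.cv (tIdx l u))) (γ u) x,
        dist_comm (γ u) (meshPoint δ (hexp.cv (tIdx l u)))]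
  -- if two times have the same index, their positions are within `2δ`
  have hsame : ∀ u v, tIdx l u = tIdx l v → |f u - f v| ≤ 2 * δ := by
    intro u v huv
    have h1 := dist_polyline_cv_le' hexp hδ.le u
    have h2 := dist_polyline_cv_le' hexp hδ.le v
    rw [huv] at h1
    rw [abs_le]
    constructor <;> linarith [dist_triangle (γ u) (meshPoint δ (hexp.cv (tIdx l v))) x,
      dist_triangle (γ v) (meshPoint δ (hexp.cv (tIdx l v))) x,
      dist_triangle (meshPoint δ (hexp.cv (tIdx l v))) (γ u) x,
      dist_triangle (meshPoint δ (hexp.cv (tIdx l v))) (γ v) x,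
      dist_comm (γ u) (meshPoint δ (hexp.cv (tIdx l v))),
      dist_comm (γ v) (meshPoint δ (hexp.cv (tIdx l v)))]
  obtain ⟨hst0, hends⟩ := hst
  have hends' : (f s ≤ ρ ∧ R ≤ f t) ∨ (R ≤ f s ∧ f t ≤ ρ) := hends
  clear hends
  have hCρ : 16 * ρ ≤ C * ρ := mul_le_mul_of_nonneg_right hC hρ.le
  -- the tight crossing of `[Cρ, R/4]` and the middle time
  have hq : C * ρ < R / 4 := by linarith
  have key : ∀ {s₀ t₀ : I}, s ≤ s₀ → s₀ < t₀ → t₀ ≤ t →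
      ((f s₀ = C * ρ ∧ f t₀ = R / 4) ∨ (f s₀ = R / 4 ∧ f t₀ = C * ρ)) →
      (∀ u, s₀ ≤ u → u ≤ t₀ → C * ρ ≤ f u ∧ f u ≤ R / 4) →
      ∃ m i' j' : ℕ, tIdx l s < m ∧ m < tIdx l t ∧ i' ≤ m ∧ m ≤ j' ∧ tIdx l s ≤ i' ∧
        j' ≤ tIdx l t ∧
        hexp.sideSeg m ⊆ ball x (R / 2) \ closedBall x (4 * ρ) ∧
        (∀ i, i' ≤ i → i ≤ j' →
          closedBall (meshPoint δ (hexp.cv i)) (4 * δ) ⊆ ball x (R / 2) \ closedBall x (4 * ρ)) ∧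
        (∀ i, i' ≤ i → i ≤ j' →
          C * ρ - δ ≤ dist (meshPoint δ (hexp.cv i)) x ∧ dist (meshPoint δ (hexp.cv i)) x ≤ R / 4 + δ) ∧
        ((dist (meshPoint δ (hexp.cv i')) x ≤ C * ρ + δ ∧ R / 4 - δ ≤ dist (meshPoint δ (hexp.cv j')) x) ∨
          (R / 4 - δ ≤ dist (meshPoint δ (hexp.cv i')) x ∧ dist (meshPoint δ (hexp.cv j')) x ≤ C * ρ + δ)) := by
    intro s₀ t₀ hss₀ hs₀t₀ ht₀t hlev hmid
    -- the middle time: `f u₀ = (Cρ + R/4)/2`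
    have hIVT : ∃ u₀ : I, s₀ ≤ u₀ ∧ u₀ ≤ t₀ ∧ f u₀ = (C * ρ + R / 4) / 2 := by
      rcases hlev with ⟨h1, h2⟩ | ⟨h1, h2⟩
      · have := intermediate_value_Icc hs₀t₀.le hfc.continuousOn
          (show (C * ρ + R / 4) / 2 ∈ Icc (f s₀) (f t₀) from
            ⟨by rw [h1]; linarith, by rw [h2]; linarith⟩)
        obtain ⟨u₀, ⟨hu1, hu2⟩, hu3⟩ := this
        exact ⟨u₀, hu1, hu2, hu3⟩
      · have := intermediate_value_Icc' hs₀t₀.le hfc.continuousOn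
          (show (C * ρ + R / 4) / 2 ∈ Icc (f t₀) (f s₀) from
            ⟨by rw [h2]; linarith, by rw [h1]; linarith⟩)
        obtain ⟨u₀, ⟨hu1, hu2⟩, hu3⟩ := this
        exact ⟨u₀, hu1, hu2, hu3⟩
    obtain ⟨u₀, hsu₀, hu₀t, hfu₀⟩ := hIVT
    refine ⟨tIdx l u₀, tIdx l s₀, tIdx l t₀, ?_, ?_, tIdx_mono l hsu₀, tIdx_mono l hu₀t,
      tIdx_mono l hss₀, tIdx_mono l ht₀t, ?_, ?_, ?_, ?_⟩
    · -- `tIdx s < tIdx u₀`: else `|f s - f u₀| ≤ 2δ`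
      refine lt_of_le_of_ne (tIdx_mono l (hss₀.trans hsu₀)) fun h => ?_
      have := hsame s u₀ h
      rw [abs_le] at this
      rcases hends' with ⟨h1, -⟩ | ⟨h1, -⟩ <;> linarith [this.1, this.2]
    · refine lt_of_le_of_ne (tIdx_mono l (hu₀t.trans ht₀t)) fun h => ?_
      have := hsame u₀ t h
      rw [abs_le] at this
      rcases hends' with ⟨-, h1⟩ | ⟨-, h1⟩ <;> linarith [this.1, this.2]
    · -- the side segment of the middle dart
      intro z hz
      have h1 := hexp.sideSeg_subset_closedBall hδ (tIdx_lt_length hexp u₀) hz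
      simp only [IsMedialExploration.leftPt] at h1
      rw [mem_closedBall] at h1
      have h2 := (hnear u₀).1
      have h3 := (hnear u₀).2
      rw [hfu₀] at h2 h3
      constructor
      · rw [mem_ball]
        linarith [dist_triangle z (meshPoint δ (hexp.cv (tIdx l u₀))) x]
      · rw [mem_closedBall, not_le]
        linarith [dist_triangle (meshPoint δ (hexp.cv (tIdx l u₀))) z x,
          dist_comm z (meshPoint δ (hexp.cv (tIdx l u₀)))]
    · intro i hi1 hi2 z hz
      obtain ⟨u, hu1, hu2, rfl⟩ := exists_time_of_tIdx l hs₀t₀.le hi1 hi2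
      obtain ⟨hm1, hm2⟩ := hmid u hu1 hu2
      rw [mem_closedBall] at hz
      have h2 := (hnear u).1
      have h3 := (hnear u).2
      constructor
      · rw [mem_ball]
        linarith [dist_triangle z (meshPoint δ (hexp.cv (tIdx l u))) x]
      · rw [mem_closedBall, not_le]
        linarith [dist_triangle (meshPoint δ (hexp.cv (tIdx l u))) z x,
          dist_comm z (meshPoint δ (hexp.cv (tIdx l u)))]
    · intro i hi1 hi2
      obtain ⟨u, hu1, hu2, rfl⟩ := exists_time_of_tIdx l hs₀t₀.le hi1 hi2
      obtain ⟨hm1, hm2⟩ := hmid u hu1 hu2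
      exact ⟨by linarith [(hnear u).2], by linarith [(hnear u).1]⟩
    · rcases hlev with ⟨h1, h2⟩ | ⟨h1, h2⟩
      · left
        exact ⟨by linarith [(hnear s₀).1], by linarith [(hnear t₀).2]⟩
      · right
        exact ⟨by linarith [(hnear s₀).2], by linarith [(hnear t₀).1]⟩
  rcases hends' with ⟨hs1, ht1⟩ | ⟨hs1, ht1⟩
  · obtain ⟨s₀, t₀, hss₀, hs₀t₀, ht₀t, hfs₀, hft₀, hmid⟩ :=
      exists_tight_crossing hfc hst0 hq (by linarith) (by linarith)
    obtain ⟨m, i', j', h1, h2, h3, h4, h5, h6, h7, h8, h9, h10⟩ :=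
      key hss₀ hs₀t₀ ht₀t (Or.inl ⟨hfs₀, hft₀⟩) hmid
    refine ⟨m, i', j', h1, h2, h3, h4, h5, h6, Or.inl ⟨?_, ?_⟩, h7, h8, h9, h10⟩
    · linarith [(hpS s).1]
    · linarith [(hpS t).2.1]
  · obtain ⟨s₀, t₀, hss₀, hs₀t₀, ht₀t, hfs₀, hft₀, hmid⟩ :=
      exists_tight_crossing' hfc hst0 hq (by linarith) (by linarith)
    obtain ⟨m, i', j', h1, h2, h3, h4, h5, h6, h7, h8, h9, h10⟩ :=
      key hss₀ hs₀t₀ ht₀t (Or.inr ⟨hfs₀, hft₀⟩) hmid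
    refine ⟨m, i', j', h1, h2, h3, h4, h5, h6, Or.inr ⟨?_, ?_⟩, h7, h8, h9, h10⟩
    · linarith [(hpS s).2.2.1]
    · linarith [(hpS t).2.2.2]

/-- **Registered sub-stub `stub_noIdle_traversalData`** (line `hitting-tournament`, stub
`stub_limitCurveRegularity_noIdle`, helper 1): `traversal_data'` with all arguments explicit.
[cite: AizenmanBurchardDuke1999, Appendix A] -/
theorem stub_noIdle_traversalData : ∀ (D' : DiscreteDobrushin) (ω : BondConfig (Site 2)) (a : MedialVertex) (l : List MedialVertex) (hexp : IsMedialExploration D' ω (a :: l)), 0 < D'.δ → ∀ (x : ℂ) (ρ R C : ℝ), D'.δ ≤ ρ → 16 ≤ C → 16 * C * ρ ≤ R → ∀ (s t : unitInterval), (⟨polyline ((a :: l).map (medialPoint D'.δ))⟩ : Curve ℂ).IsTraversal x ρ R s t → ∃ m i' j' : ℕ, tIdx l s < m ∧ m < tIdx l t ∧ i' ≤ m ∧ m ≤ j' ∧ tIdx l s ≤ i' ∧ j' ≤ tIdx l t ∧ ((dist (hexp.pS (tIdx l s)) x ≤ 4 * ρ ∧ R / 2 ≤ dist (hexp.pT (tIdx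 l t)) x) ∨ (R / 2 ≤ dist (hexp.pS (tIdx l s)) x ∧ dist (hexp.pT (tIdx l t)) x ≤ 4 * ρ)) ∧ hexp.sideSeg m ⊆ Metric.ball x (R / 2) \ Metric.closedBall x (4 * ρ) ∧ (∀ i, i' ≤ i → i ≤ j' → Metric.closedBall (meshPoint D'.δ (hexp.cv i)) (4 * D'.δ) ⊆ Metric.ball x (R / 2) \ Metric.closedBall x (4 * ρ)) ∧ (∀ i, i' ≤ i → i ≤ j' → C * ρ - D'.δ ≤ dist (meshPoint D'.δ (hexp.cv i)) x ∧ dist (meshPoint D'.δ (hexp.cv i)) x ≤ R / 4 + D'.δ) ∧ ((dist (meshPoint D'.δ (hexp.cv i')) x ≤ C * ρ + D'.δ ∧ R / 4 - D'.δ ≤ dist (meshPoint D'.δ (hexp.cv j')) x) ∨ (R / 4 - D'.δ ≤ dist (meshPoint D'.δ (hexp.cv i')) x ∧ dist (meshPoint D'.δ (hexp.cv j')) x ≤ C * ρ + D'.δ)) :=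
  fun _ _ _ _ hexp hδ _ _ _ _ hδρ hC hR _ _ hst => traversal_data' hexp hδ hδρ hC hR hst

end Summit.CriticalPhenomena.CardyFormulaZ2.Cruxes.LagHandOff.HittingTournament

end
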